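import Literature.NumberTheory.Automorphic.RankOneOrbitBruhat
import HarnessLib

/-!
# The rank-one orbit analysis for an arbitrary Borel subgroup, I: data, fixed points, weights,
# weight raising, limits (trunk T-AUTOMORPHIC, G25 AutomorphicL; towards Springer 7.3.3 (ii))

`RankOneOrbit.lean` – `RankOneOrbitBruhat.lean` carry out Springer's analysis of `G/B ⊂ ℙ(V)` in
semisimple rank one (*Linear Algebraic Groups*, 2nd ed., 7.1.5, 7.2.2) under the hypothesis
structure `RankOneOrbitData`, which presupposes that `B = T · U_α` **is** a Borel subgroup and that
`Z_G(T) = T` — i.e. the named facts `exists_rootHom_sup_isBorelIn_of_central` (7.3.3 (ii)) and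
`centralizer_eq_of_isMaximalTorusIn` (7.6.4 (ii)). In order to *prove* 7.3.3 (ii)
(`SemisimpleRankOneBorel.lean`) the same analysis is redone here for the weaker data
`RankOneBorelData G T B α u m ρ v`:

* `B` is *any* Borel subgroup of `G` containing `T` and `U_α = u(𝔾ₐ)` and the stabiliser of the
  line `[v]` of the rational representation `ρ` (Chevalley 5.5.3), with closed orbit cone
  (6.2.7 (ii)) and `ρ(T)` diagonal;
* `Z_G(T) = T` is replaced by `Z_G(T) ⊆ B` (Springer 6.4.8 (ii), the tree's theorem
  `centralizer_le_of_isBorelIn_holds`);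
* the Weyl element `m ∈ N_G(T)` is only assumed to lie outside `B`, and the single extra input
  `inter` — *`m⁻¹ u(y) m ∈ B` forces `y = 0`*, i.e. `U_α ∩ m B m⁻¹ = {e}` (Springer 7.2.3 (i)) —
  replaces the use of the opposite root group inside `T · U_α`; in `SemisimpleRankOneBorel.lean`
  it is derived from Chevalley's theorem on the unipotent radical (Luna's form,
  `unipotent_eq_bot_of_forall_isBorelIn_le_holds`).

The statements below are deliberately parallel to those of the `RankOneOrbitData` files (the gate
flags them as near-duplicates): `RankOneOrbitData` is the special case `B = T · U_α`, `Z_G(T) = T`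
(`RankOneOrbitData.toBorelData`, whence the old results could be re-derived from the present ones
by a librarian), but its fields cannot be weakened in place without breaking its importers.

Contents (all proved; the proofs are those of the `RankOneOrbitData` files, mutatis mutandis):
`mem_centralizer_or_of_mem_normalizer_of_central` (`N_G(T) ⊆ Z_G(T) ∪ m Z_G(T)`, 7.1.4);
`RankOneBorelData` and its API: `mem_or_exists_of_conj_le`, **`smul_or_smul_of_fixed`** (the
`T`-fixed lines of the orbit are `[v]`, `[ρ(m) v]`), the weights `wt`, `wtInt`, `rho_cochar`, the
separation lemma `wt_eq_of_wtInt_eq`; weight raising `rho_uval_mulVec_apply`; the opposite root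
homomorphism `isRootHom_weyl`; `eq_zero_of_rho_uval_fix`; limits `botPart_smul_or_smul`,
`topPart_smul_or_smul`; extremal weights `Mv`, `Mz`, **`Mz_lt_Mv`**; charts `exists_low_coords`,
`exists_high_coords`. Part II (`RankOneBorelBruhat.lean`): slice, Bruhat decomposition
`G = B ∪ U_α m B`, and the consequences `B = T · U_α`, 7.3.3 (ii).

## References

* [SpringerLAG1998] T. A. Springer, *Linear Algebraic Groups*, 2nd ed. (1998): 3.2.11, 5.5.3,
  6.2.7, 6.4.8, 7.1.1, 7.1.4–7.1.5, 7.2.1–7.2.3, 7.3.3.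
-/

open scoped MatrixGroups IsMulCommutative
open Matrix

namespace Literature.NumberTheory.Automorphic

variable {k : Type*} [Field k] {n : Type*} [Fintype n] [DecidableEq n]

attribute [local instance] zariskiTopologyPi

/-! ### `N_G(T) ⊆ Z_G(T) ∪ m Z_G(T)` -/

section Weyl

variable {G T : Subgroup (GL n k)}

/-- **`N_G(T) ⊆ Z_G(T) ∪ m Z_G(T)` in semisimple rank one** (Springer 7.1.4: the Weyl group of
`G_α` has order `≤ 2`; for `G` algebraic with a torus `T`, a non-trivial `α ∈ X*(T)` with `(Ker α)°`
central and `m ∈ N_G(T) ∖ Z_G(T)`): an element of `N_G(T)` maps `α` to `α^{±1}`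
(`charConj_eq_or_eq_inv_of_central`); if it fixes `α` it centralises `T`
(`mem_centralizer_of_charConj_eq_of_central`), and two elements inverting `α` differ by such.
The version `mem_or_mem_of_mem_normalizer_of_central` of `RankOneOrbit.lean` assumes moreover
`Z_G(T) = T`. [cite: SpringerLAG1998, 7.1.4] -/
theorem mem_centralizer_or_of_mem_normalizer_of_central [IsAlgClosed k] (hG : IsAlgebraicSubgroup G)
    (hT : IsTorusSubgroup T) {α : ↥(characterLattice T)} (hα1 : (α : ↥T →* kˣ) ≠ 1)
    (hcen : G ≤ Subgroup.centralizer
      ((identityComponent ((α : ↥T →* kˣ).ker.map T.subtype) : Subgroup (GL n k)) :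
        Set (GL n k)))
    {m : GL n k} (hmG : m ∈ G) (hmN : m ∈ Subgroup.normalizer (T : Set (GL n k)))
    (hmZ : m ∉ Subgroup.centralizer (T : Set (GL n k)))
    {x : GL n k} (hxG : x ∈ G) (hxN : x ∈ Subgroup.normalizer (T : Set (GL n k))) :
    x ∈ Subgroup.centralizer (T : Set (GL n k)) ∨
      m⁻¹ * x ∈ Subgroup.centralizer (T : Set (GL n k)) := by
  have hminv : charConj hmN α = α⁻¹ := by
    rcases charConj_eq_or_eq_inv_of_central hG hT hα1 hcen hmG hmN with h | h
    · exact absurd (mem_centralizer_of_charConj_eq_of_central hG hT hα1 hcen hmG hmN h) hmZ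
    · exact h
  rcases charConj_eq_or_eq_inv_of_central hG hT hα1 hcen hxG hxN with h | h
  · exact Or.inl (mem_centralizer_of_charConj_eq_of_central hG hT hα1 hcen hxG hxN h)
  · right
    have hm'N : m⁻¹ * x ∈ Subgroup.normalizer (T : Set (GL n k)) :=
      Subgroup.mul_mem _ (Subgroup.inv_mem _ hmN) hxN
    have hm'G : m⁻¹ * x ∈ G := G.mul_mem (G.inv_mem hmG) hxG
    refine mem_centralizer_of_charConj_eq_of_central hG hT hα1 hcen hm'G hm'N ?_
    have e₁ : charConj (Subgroup.inv_mem _ hmN) α = α⁻¹ := by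
      have h1 := charConj_inv_charConj hmN α
      rw [hminv, map_inv, inv_eq_iff_eq_inv] at h1
      exact h1
    rw [show charConj hm'N α = charConj hxN (charConj (Subgroup.inv_mem _ hmN) α) from
      charConj_mul (Subgroup.inv_mem _ hmN) hxN α, e₁, map_inv, h, inv_inv]

/-- `N_G(T)` normalises `Z_G(T)`: if `x` centralises `T` and `m` normalises `T` then so does
`m⁻¹ x m`. [folklore] -/
theorem conj_mem_centralizer_of_mem_normalizer {m x : GL n k}
    (hmN : m ∈ Subgroup.normalizer (T : Set (GL n k)))
    (hx : x ∈ Subgroup.centralizer (T : Set (GL n k))) :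
    m⁻¹ * x * m ∈ Subgroup.centralizer (T : Set (GL n k)) := by
  rw [Subgroup.mem_centralizer_iff] at hx ⊢
  intro t ht
  have ht' : m * t * m⁻¹ ∈ T := (Subgroup.mem_normalizer_iff.1 hmN t).1 ht
  have hc := hx _ ht'
  calc t * (m⁻¹ * x * m) = m⁻¹ * ((m * t * m⁻¹) * x) * m := by group
    _ = m⁻¹ * (x * (m * t * m⁻¹)) * m := by rw [hc]
    _ = m⁻¹ * x * m * t := by group

end Weyl

/-! ### The data -/

section Data

/-- **The data of the rank-one orbit analysis for an arbitrary Borel subgroup** (Springer 7.1.5,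
7.2.1–7.2.2, before 7.3.3 is known): a Zariski-connected `G ≤ GL n k`, a maximal torus `T`, a
root `α` with `(Ker α)°` central and a root homomorphism `u`, a Borel subgroup `B` containing `T`,
`U_α = u(𝔾ₐ)` and `Z_G(T)` (6.4.8 (ii)), an element `m ∈ N_G(T) ∩ G` outside `B` with
`U_α ∩ m B m⁻¹ = {e}` (7.2.3 (i)), and a rational representation `ρ : G → GL_N(k)` with a vector
`v ≠ 0` whose line has stabiliser exactly `B` (5.5.3), `ρ(T)` diagonal and closed orbit cone
(6.2.7 (ii)). `RankOneOrbitData` (`RankOneOrbit.lean`) is the special case `B = T · U_α`,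
`Z_G(T) = T`. [cite: SpringerLAG1998, 7.1.5 (proof)] -/
structure RankOneBorelData (G T B : Subgroup (GL n k)) (α : ↥(characterLattice T))
    (u : Multiplicative k →* ↥G) (m : GL n k) {N : ℕ} (ρ : ↥G →* GL (Fin N) k)
    (v : Fin N → k) : Prop where
  /-- `G` is Zariski-connected. -/
  conn : IsZConnected G
  /-- `T` is a maximal torus of `G`. -/
  maxTorus : IsMaximalTorusIn T G
  /-- `α` is a root. -/
  mem_roots : α ∈ roots G T
  /-- `(Ker α)°` is central in `G`. -/
  central : G ≤ Subgroup.centralizer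
    ((identityComponent ((α : ↥T →* kˣ).ker.map T.subtype) : Subgroup (GL n k)) : Set (GL n k))
  /-- `u` is a root homomorphism for `α`. -/
  rootHom : IsRootHom G T maxTorus.1 (α : ↥T →* kˣ) u
  /-- `B` is a Borel subgroup of `G`. -/
  borel : IsBorelIn B G
  /-- `T ≤ B`. -/
  torus_le : T ≤ B
  /-- `U_α = u(𝔾ₐ) ≤ B`. -/
  range_le : u.range.map G.subtype ≤ B
  /-- `Z_G(T) ≤ B` (Springer 6.4.8 (ii)). -/
  centralizer_le : G ⊓ Subgroup.centralizer (T : Set (GL n k)) ≤ B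
  /-- `m ∈ G`. -/
  memG : m ∈ G
  /-- `m` normalises `T`. -/
  memN : m ∈ Subgroup.normalizer (T : Set (GL n k))
  /-- `m ∉ B`. -/
  notMemB : m ∉ B
  /-- `U_α ∩ m B m⁻¹ = {e}`: if `m⁻¹ u(y) m ∈ B` then `y = 0` (Springer 7.2.3 (i)). -/
  inter : ∀ y : k, m⁻¹ * uval u y * m ∈ B → y = 0
  /-- `ρ` is an algebraic homomorphism. -/
  algebraic : MonoidHom.IsAlgebraicGL ρ
  /-- `v ≠ 0`. -/
  ne_zero : v ≠ 0
  /-- The stabiliser of the line `k v` in `G` is exactly `B`. -/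
  stab_iff : ∀ g : ↥G, (∃ c : k, ((ρ g : GL (Fin N) k) : Matrix (Fin N) (Fin N) k) *ᵥ v = c • v) ↔
    (g : GL n k) ∈ B
  /-- `ρ(T)` consists of diagonal matrices. -/
  diag : ∀ t : ↥T, ∃ d : Fin N → k,
    ((ρ ⟨t, maxTorus.1 t.2⟩ : GL (Fin N) k) : Matrix (Fin N) (Fin N) k) = Matrix.diagonal d
  /-- The orbit cone of `v` under `ρ(G)` is closed. -/
  closed : IsClosed (orbitCone ρ.range v)

namespace RankOneBorelData

open RankOneOrbitData (rho_mul_mulVec rho_mulVec_mem v_mem)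

variable {G T B : Subgroup (GL n k)} {α : ↥(characterLattice T)} {u : Multiplicative k →* ↥G}
  {m : GL n k} {N : ℕ} {ρ : ↥G →* GL (Fin N) k} {v : Fin N → k}
variable (h : RankOneBorelData G T B α u m ρ v)
include h

/-- `G` is algebraic. [folklore] -/
theorem alg : IsAlgebraicSubgroup G := h.conn.1

/-- `T` is a torus. [folklore] -/
theorem torus : IsTorusSubgroup T := h.maxTorus.2.1

/-- `α ≠ 1`. [folklore] -/
theorem ne_one : (α : ↥T →* kˣ) ≠ 1 := h.mem_roots.1

/-- `m ∉ Z_G(T)` (as `Z_G(T) ⊆ B ∌ m`). [folklore] -/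
theorem notMemZ : m ∉ Subgroup.centralizer (T : Set (GL n k)) := fun hZ =>
  h.notMemB (h.centralizer_le (Subgroup.mem_inf.2 ⟨h.memG, hZ⟩))

/-- `N_G(T) ⊆ Z_G(T) ∪ m Z_G(T)`. [cite: SpringerLAG1998, 7.1.4] -/
theorem mem_or_mem [IsAlgClosed k] {x : GL n k} (hxG : x ∈ G)
    (hxN : x ∈ Subgroup.normalizer (T : Set (GL n k))) :
    x ∈ G ⊓ Subgroup.centralizer (T : Set (GL n k)) ∨
      m⁻¹ * x ∈ G ⊓ Subgroup.centralizer (T : Set (GL n k)) := by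
  rcases mem_centralizer_or_of_mem_normalizer_of_central h.alg h.torus h.ne_one h.central h.memG
    h.memN h.notMemZ hxG hxN with h1 | h1
  · exact Or.inl (Subgroup.mem_inf.2 ⟨hxG, h1⟩)
  · exact Or.inr (Subgroup.mem_inf.2 ⟨G.mul_mem (G.inv_mem h.memG) hxG, h1⟩)

/-- `m² ∈ Z_G(T)`. [cite: SpringerLAG1998, 7.2.1] -/
theorem sq_mem [IsAlgClosed k] : m * m ∈ G ⊓ Subgroup.centralizer (T : Set (GL n k)) := by
  rcases h.mem_or_mem (G.mul_mem h.memG h.memG) (Subgroup.mul_mem _ h.memN h.memN) with h1 | h1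
  · exact h1
  · rw [← mul_assoc, inv_mul_cancel, one_mul] at h1
    exact absurd (Subgroup.mem_inf.1 h1).2 h.notMemZ

/-- **The `T`-fixed points of `G/B`** (Springer 7.1.4 with 6.4.12; 7.1.5 (i)): if `g⁻¹ T g ⊆ B`
then `g ∈ B` or `g ∈ m B` (conjugacy of maximal tori in `B`,
`isMaximalTorusIn_conj_of_isSolvable_holds`, `N_G(T) ⊆ Z_G(T) ∪ m Z_G(T)` and `Z_G(T) ⊆ B`).
[cite: SpringerLAG1998, 7.1.4–7.1.5 (i)] -/
theorem mem_or_exists_of_conj_le [IsAlgClosed k] {g : GL n k} (hg : g ∈ G)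
    (hle : T.map (MulAut.conj g⁻¹ : GL n k →* GL n k) ≤ B) :
    g ∈ B ∨ ∃ b ∈ B, g = m * b := by
  have hBor := h.borel
  -- `g⁻¹ T g` and `T` are maximal tori of `B`
  have h1 : IsMaximalTorusIn (T.map (MulAut.conj g⁻¹ : GL n k →* GL n k)) B := by
    have h0 := h.maxTorus.map_conj g⁻¹
    rw [RankOneOrbitData.map_conj_eq_of_mem (G.inv_mem hg)] at h0
    exact ⟨hle, h0.2.1, fun T' a b c => h0.2.2 T' a (b.trans hBor.1) c⟩
  have h2 : IsMaximalTorusIn T B :=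
    ⟨h.torus_le, h.torus, fun T' a b c => h.maxTorus.2.2 T' a (b.trans hBor.1) c⟩
  obtain ⟨b, hb, hbT⟩ := isMaximalTorusIn_conj_of_isSolvable_holds hBor.2.1 hBor.2.2.1 h2 h1
  -- `x = b⁻¹ g⁻¹` normalises `T`
  have hx : T.map (MulAut.conj (b⁻¹ * g⁻¹) : GL n k →* GL n k) = T := by
    rw [← map_conj_map_conj, hbT, map_conj_inv_map_conj]
  have hxN : b⁻¹ * g⁻¹ ∈ Subgroup.normalizer (T : Set (GL n k)) :=
    Subgroup.mem_normalizer_iff_map_conj_eq.2 hx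
  have hbG : b ∈ G := hBor.1 hb
  have hxG : b⁻¹ * g⁻¹ ∈ G := G.mul_mem (G.inv_mem hbG) (G.inv_mem hg)
  rcases h.mem_or_mem hxG hxN with h3 | h3
  · left
    have : g = (b⁻¹ * g⁻¹)⁻¹ * b⁻¹ := by group
    rw [this]
    exact B.mul_mem (B.inv_mem (h.centralizer_le h3)) (B.inv_mem hb)
  · right
    -- `m⁻¹ b⁻¹ g⁻¹ = z ∈ Z_G(T)`, so `g = z⁻¹ m⁻¹ b⁻¹ = m (m⁻¹ z⁻¹ m) m⁻² b⁻¹`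
    have hz' : m⁻¹ * (m⁻¹ * (b⁻¹ * g⁻¹))⁻¹ * m ∈ G ⊓ Subgroup.centralizer (T : Set (GL n k)) := by
      obtain ⟨hzG, hzZ⟩ := Subgroup.mem_inf.1 h3
      exact Subgroup.mem_inf.2 ⟨G.mul_mem (G.mul_mem (G.inv_mem h.memG) (G.inv_mem hzG)) h.memG,
        conj_mem_centralizer_of_mem_normalizer h.memN ((Subgroup.centralizer _).inv_mem hzZ)⟩
    refine ⟨m⁻¹ * (m⁻¹ * (b⁻¹ * g⁻¹))⁻¹ * m * (m * m)⁻¹ * b⁻¹, B.mul_mem (B.mul_mem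
      (h.centralizer_le hz') (B.inv_mem (h.centralizer_le h.sq_mem))) (B.inv_mem hb), ?_⟩
    group

/-- Elements of `B` fix the line of `v`. [folklore] -/
theorem exists_smul_of_mem_borel {b : GL n k} (hbG : b ∈ G) (hb : b ∈ B) :
    ∃ c : k, ((ρ ⟨b, hbG⟩ : GL (Fin N) k) : Matrix (Fin N) (Fin N) k) *ᵥ v = c • v :=
  (h.stab_iff ⟨b, hbG⟩).2 hb

/-- If `ρ(t)` fixes the line of `ρ(g) v` then `g⁻¹ t g ∈ B`. [folklore] -/
theorem conj_mem_borel_of_fixed {g : ↥G} {t : GL n k} (htG : t ∈ G)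
    (hfix : ∃ c : k, ((ρ ⟨t, htG⟩ : GL (Fin N) k) : Matrix (Fin N) (Fin N) k) *ᵥ
      (((ρ g : GL (Fin N) k) : Matrix (Fin N) (Fin N) k) *ᵥ v) =
      c • (((ρ g : GL (Fin N) k) : Matrix (Fin N) (Fin N) k) *ᵥ v)) :
    (g : GL n k)⁻¹ * t * g ∈ B := by
  obtain ⟨c, hc⟩ := hfix
  have hmem : (g : GL n k)⁻¹ * t * g ∈ G := G.mul_mem (G.mul_mem (G.inv_mem g.2) htG) g.2
  have key : ((ρ ⟨(g : GL n k)⁻¹ * t * g, hmem⟩ : GL (Fin N) k) : Matrix (Fin N) (Fin N) k) *ᵥ v =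
      c • v := by
    have e : (⟨(g : GL n k)⁻¹ * t * g, hmem⟩ : ↥G) = g⁻¹ * ⟨t, htG⟩ * g := rfl
    rw [e, rho_mul_mulVec, rho_mul_mulVec, hc, Matrix.mulVec_smul, ← rho_mul_mulVec,
      inv_mul_cancel, map_one, Units.val_one, Matrix.one_mulVec]
  exact (h.stab_iff _).1 ⟨c, key⟩

/-- **`X^T = {x₀, x_∞}`** (Springer 7.1.5 (i)): if the line of `ρ(g) v` is fixed by `ρ(T)` then
`ρ(g) v` is a multiple of `v` or of `ρ(m) v`. [cite: SpringerLAG1998, 7.1.5 (i) (proof)] -/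
theorem smul_or_smul_of_fixed [IsAlgClosed k] {g : ↥G}
    (hfix : ∀ t : ↥T, ∃ c : k, ((ρ ⟨t, h.maxTorus.1 t.2⟩ : GL (Fin N) k) : Matrix (Fin N) (Fin N) k) *ᵥ
      (((ρ g : GL (Fin N) k) : Matrix (Fin N) (Fin N) k) *ᵥ v) =
      c • (((ρ g : GL (Fin N) k) : Matrix (Fin N) (Fin N) k) *ᵥ v)) :
    (∃ c : k, ((ρ g : GL (Fin N) k) : Matrix (Fin N) (Fin N) k) *ᵥ v = c • v) ∨
      ∃ c : k, ((ρ g : GL (Fin N) k) : Matrix (Fin N) (Fin N) k) *ᵥ v =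
        c • (((ρ ⟨m, h.memG⟩ : GL (Fin N) k) : Matrix (Fin N) (Fin N) k) *ᵥ v) := by
  have hle : T.map (MulAut.conj (g : GL n k)⁻¹ : GL n k →* GL n k) ≤ B := by
    rintro _ ⟨t, ht, rfl⟩
    have := h.conj_mem_borel_of_fixed (g := g) (h.maxTorus.1 ht) (hfix ⟨t, ht⟩)
    simpa [MulAut.conj_apply, mul_assoc] using this
  rcases h.mem_or_exists_of_conj_le g.2 hle with hgB | ⟨b, hb, hgb⟩
  · exact Or.inl ((h.stab_iff g).2 hgB)
  · right
    have hbG : b ∈ G := h.borel.1 hb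
    obtain ⟨c, hc⟩ := h.exists_smul_of_mem_borel hbG hb
    refine ⟨c, ?_⟩
    have e : g = ⟨m, h.memG⟩ * ⟨b, hbG⟩ := Subtype.ext hgb
    rw [e, rho_mul_mulVec, hc, Matrix.mulVec_smul]

/-! #### The weights of `T` on `kᴺ` -/

/-- The diagonal entries of `ρ(t)`: `ρ(t) = diag(ρ(t)ᵢᵢ)`. [folklore] -/
theorem rho_torus_eq_diagonal (t : ↥T) :
    ((ρ ⟨t, h.maxTorus.1 t.2⟩ : GL (Fin N) k) : Matrix (Fin N) (Fin N) k) =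
      Matrix.diagonal fun i => ((ρ ⟨t, h.maxTorus.1 t.2⟩ : GL (Fin N) k) : Matrix (Fin N) (Fin N) k) i i := by
  obtain ⟨d, hd⟩ := h.diag t
  rw [hd]
  ext i j
  by_cases hij : i = j
  · subst hij; simp
  · simp [Matrix.diagonal_apply_ne _ hij]

/-- The diagonal entries of `ρ(t)` are non-zero. [folklore] -/
theorem rho_torus_apply_ne_zero (t : ↥T) (i : Fin N) :
    ((ρ ⟨t, h.maxTorus.1 t.2⟩ : GL (Fin N) k) : Matrix (Fin N) (Fin N) k) i i ≠ 0 := by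
  intro h0
  have hdet := (ρ ⟨t, h.maxTorus.1 t.2⟩).isUnit.map Matrix.detMonoidHom
  rw [Matrix.coe_detMonoidHom, h.rho_torus_eq_diagonal t, Matrix.det_diagonal] at hdet
  apply hdet.ne_zero
  exact Finset.prod_eq_zero (Finset.mem_univ i) (by simpa using h0)

/-- **The weights `χᵢ : T → 𝔾ₘ` of `T` on `kᴺ`**: `ρ(t) = diag(χᵢ(t))` (Springer 7.1.1: the weights
of `T` in `V`). [cite: SpringerLAG1998, 7.1.1] -/
noncomputable def wt (i : Fin N) : ↥T →* kˣ where
  toFun t := Units.mk0 _ (h.rho_torus_apply_ne_zero t i)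
  map_one' := Units.ext (by
    simp only [Units.val_mk0, Units.val_one]
    have : (⟨((1 : ↥T) : GL n k), h.maxTorus.1 (1 : ↥T).2⟩ : ↥G) = 1 := rfl
    rw [this, map_one, Units.val_one, Matrix.one_apply_eq])
  map_mul' s t := Units.ext (by
    simp only [Units.val_mk0, Units.val_mul]
    have : (⟨((s * t : ↥T) : GL n k), h.maxTorus.1 (s * t).2⟩ : ↥G) =
        ⟨(s : GL n k), h.maxTorus.1 s.2⟩ * ⟨(t : GL n k), h.maxTorus.1 t.2⟩ := rfl
    rw [this, map_mul, Units.val_mul, h.rho_torus_eq_diagonal s, h.rho_torus_eq_diagonal t,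
      Matrix.diagonal_mul_diagonal, Matrix.diagonal_apply_eq, Matrix.diagonal_apply_eq,
      Matrix.diagonal_apply_eq])

/-- `χᵢ(t) = ρ(t)ᵢᵢ`. [folklore] -/
@[simp] theorem coe_wt (i : Fin N) (t : ↥T) :
    ((h.wt i t : kˣ) : k) = ((ρ ⟨t, h.maxTorus.1 t.2⟩ : GL (Fin N) k) : Matrix (Fin N) (Fin N) k) i i := rfl

/-- `ρ(t) w = (χᵢ(t) wᵢ)ᵢ`. [folklore] -/
theorem rho_torus_mulVec (t : ↥T) (w : Fin N → k) :
    ((ρ ⟨t, h.maxTorus.1 t.2⟩ : GL (Fin N) k) : Matrix (Fin N) (Fin N) k) *ᵥ w =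
      fun i => ((h.wt i t : kˣ) : k) * w i := by
  rw [h.rho_torus_eq_diagonal t]
  funext i
  rw [Matrix.mulVec_diagonal]
  rfl

/-- The weights are algebraic characters (`ρ` is algebraic). [folklore] -/
theorem isAlgebraicChar_wt (i : Fin N) : IsAlgebraicChar (h.wt i) := by
  obtain ⟨P, hP⟩ := h.algebraic
  refine ⟨P (Sum.inl (i, i)), fun t => ?_⟩
  rw [coe_wt, ← glCoordFun_inl, hP]

/-- The weight `χᵢ` as an element of `X*(T)`. [folklore] -/
noncomputable def wtL (i : Fin N) : ↥(characterLattice T) := ⟨h.wt i, h.isAlgebraicChar_wt i⟩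

/-- `wtL` coerces to `wt`. [folklore] -/
@[simp] theorem coe_wtL (i : Fin N) : (h.wtL i : ↥T →* kˣ) = h.wt i := rfl

/-- **A cocharacter `λ` with `⟨α, λ⟩ > 0`** (by the perfect pairing 3.2.11 (i),
`exists_dualBases_of_isTorusSubgroup`). [folklore] -/
theorem exists_cochar_pos [IsAlgClosed k] :
    haveI : IsMulCommutative ↥T := h.torus.2.1
    ∃ γ : ↥(cocharacterLattice T), 0 < charPairingInt (α : ↥T →* kˣ) (γ : kˣ →* ↥T) := by
  haveI : IsMulCommutative ↥T := h.torus.2.1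
  obtain ⟨r, bX, bY, hpair⟩ := exists_dualBases_of_isTorusSubgroup h.torus
  have hne : bX (Additive.ofMul α) ≠ 0 := by
    intro h0
    apply h.ne_one
    have : Additive.ofMul α = 0 := bX.injective (by rw [h0, map_zero])
    rw [show α = 1 from Additive.ofMul.injective this, Subgroup.coe_one]
  obtain ⟨i, hi⟩ : ∃ i, bX (Additive.ofMul α) i ≠ 0 := by
    by_contra! h0; exact hne (funext h0)
  set d : ℤ := bX (Additive.ofMul α) i with hd
  -- the cocharacter `± e_i^∨`
  set γ : ↥(cocharacterLattice T) := Additive.toMul (bY.symm (Pi.single i (Int.sign d))) with hγ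
  refine ⟨γ, ?_⟩
  rw [hpair, hγ]
  simp only [ofMul_toMul, AddEquiv.apply_symm_apply]
  rw [Finset.sum_eq_single i]
  · rw [Pi.single_eq_same, ← hd]
    rcases lt_trichotomy d 0 with hlt | heq | hgt
    · rw [Int.sign_eq_neg_one_of_neg hlt]; nlinarith
    · exact absurd heq hi
    · rw [Int.sign_eq_one_of_pos hgt]; linarith
  · intro j _ hji; rw [Pi.single_eq_of_ne hji, mul_zero]
  · intro hi'; exact absurd (Finset.mem_univ i) hi'

/-- The integer weights `mᵢ = ⟨χᵢ, γ⟩` of a cocharacter `γ` on `kᴺ`. [folklore] -/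
noncomputable def wtInt [IsMulCommutative ↥T] (γ : ↥(cocharacterLattice T)) (i : Fin N) : ℤ :=
  charPairingInt (h.wt i) (γ : kˣ →* ↥T)

/-- **`ρ(γ(c)) = diag(c^{mᵢ})`** (`χᵢ(γ(c)) = c^{⟨χᵢ, γ⟩}`, 3.2.11 (i) /
`charPairingInt_spec_holds`). [cite: SpringerLAG1998, 3.2.11 (i)] -/
theorem rho_cochar [IsAlgClosed k] [IsMulCommutative ↥T] (γ : ↥(cocharacterLattice T)) (c : kˣ) :
    ((ρ ⟨((γ : kˣ →* ↥T) c : GL n k), h.maxTorus.1 ((γ : kˣ →* ↥T) c).2⟩ : GL (Fin N) k) :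
        Matrix (Fin N) (Fin N) k) = ((weightDiagGL (h.wtInt γ) c : GL (Fin N) k) : Matrix (Fin N) (Fin N) k) := by
  rw [h.rho_torus_eq_diagonal ((γ : kˣ →* ↥T) c), weightDiagGL, coe_diagonalGL]
  congr 1
  funext i
  have h1 := charPairingInt_spec_holds (T := T) (h.isAlgebraicChar_wt i) γ.2 c
  rw [← h.coe_wt, h1]
  rfl

/-- **`S = (Ker α)°` acts on the orbit cone by scalars** (`S` is central and fixes the line of `v`).
[folklore] -/
theorem exists_forall_rho_eq_smul {s : GL n k}
    (hs : s ∈ identityComponent ((α : ↥T →* kˣ).ker.map T.subtype)) :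
    ∃ (hsG : s ∈ G) (c : k), ∀ w ∈ orbitCone ρ.range v,
      ((ρ ⟨s, hsG⟩ : GL (Fin N) k) : Matrix (Fin N) (Fin N) k) *ᵥ w = c • w := by
  have hsT : s ∈ T := by
    obtain ⟨t, -, rfl⟩ := identityComponent_le _ hs
    exact t.2
  have hsG : s ∈ G := h.maxTorus.1 hsT
  obtain ⟨c, hc⟩ := h.exists_smul_of_mem_borel hsG (h.torus_le hsT)
  refine ⟨hsG, c, ?_⟩
  rintro w ⟨a, _, ⟨g, rfl⟩, rfl⟩
  have hcomm : g * ⟨s, hsG⟩ = ⟨s, hsG⟩ * g :=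
    Subtype.ext ((Subgroup.mem_centralizer_iff.1 (h.central g.2) s hs).symm)
  rw [Matrix.mulVec_smul, ← rho_mul_mulVec, ← hcomm, rho_mul_mulVec, hc, Matrix.mulVec_smul,
    smul_comm]

/-- **Separation of weights** (the lattice content of 7.1.4 "*`T/S` is isomorphic to `𝔾ₘ`*"): for a
point `w` of the orbit cone and two indices in its support, if the integer weights of a cocharacter
`γ` with `⟨α, γ⟩ ≠ 0` agree then the characters agree: `χᵢ/χⱼ` is trivial on `S` (which acts on
`w` by a scalar), hence commensurable with `α` (`exists_zpow_eq_zpow_of_mem_charactersTrivialOn`),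
and `X*(T)` is torsion-free. [cite: SpringerLAG1998, 7.1.4] -/
theorem wt_eq_of_wtInt_eq [IsAlgClosed k] [IsMulCommutative ↥T] {γ : ↥(cocharacterLattice T)}
    (hγ : charPairingInt (α : ↥T →* kˣ) (γ : kˣ →* ↥T) ≠ 0) {w : Fin N → k}
    (hw : w ∈ orbitCone ρ.range v) {i j : Fin N} (hi : w i ≠ 0) (hj : w j ≠ 0)
    (hij : h.wtInt γ i = h.wtInt γ j) : h.wt i = h.wt j := by
  haveI := isMulTorsionFree_characterLattice h.torus.1
  -- `χᵢ/χⱼ` is trivial on `S`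
  have htriv : h.wtL i / h.wtL j ∈ charactersTrivialOn T
      (identityComponent ((α : ↥T →* kˣ).ker.map T.subtype)) := by
    rw [mem_charactersTrivialOn_iff]
    intro t ht
    obtain ⟨htG, c, hc⟩ := h.exists_forall_rho_eq_smul ht
    have hw' := hc w hw
    rw [show (⟨(t : GL n k), htG⟩ : ↥G) = ⟨t, h.maxTorus.1 t.2⟩ from rfl, h.rho_torus_mulVec] at hw'
    have h1 := congrFun hw' i
    have h2 := congrFun hw' j
    simp only [Pi.smul_apply, smul_eq_mul] at h1 h2
    have e1 : ((h.wt i t : kˣ) : k) = c := mul_right_cancel₀ hi h1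
    have e2 : ((h.wt j t : kˣ) : k) = c := mul_right_cancel₀ hj h2
    apply Units.ext
    rw [Subgroup.coe_div, MonoidHom.div_apply, Units.val_div_eq_div_val, coe_wtL, coe_wtL, e1, e2,
      div_self (e1 ▸ (h.wt i t).ne_zero), Units.val_one]
  obtain ⟨a, c, ha, hac⟩ := exists_zpow_eq_zpow_of_mem_charactersTrivialOn h.torus h.ne_one htriv
  -- pair with `γ`
  have hpair := congrArg (fun χ : ↥(characterLattice T) => charPairingInt (χ : ↥T →* kˣ) (γ : kˣ →* ↥T)) hac
  simp only [SubgroupClass.coe_zpow] at hpair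
  rw [charPairingInt_zpow_left (h.wtL i / h.wtL j).2 γ.2, charPairingInt_zpow_left α.2 γ.2,
    Subgroup.coe_div, div_eq_mul_inv, charPairingInt_mul_left (h.wtL i).2 (h.wtL j).2.inv γ.2,
    charPairingInt_inv_left (h.wtL j).2 γ.2] at hpair
  have h0 : c = 0 := by
    have : a * (h.wtInt γ i + -h.wtInt γ j) = c * charPairingInt (α : ↥T →* kˣ) (γ : kˣ →* ↥T) := hpair
    rw [hij, add_neg_cancel, mul_zero] at this
    exact (mul_eq_zero.1 this.symm).resolve_right hγ
  rw [h0, zpow_zero] at hac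
  have hnat : (h.wtL i / h.wtL j) ^ a.natAbs = 1 := by
    rcases Int.natAbs_eq a with e | e
    · rw [← zpow_natCast, ← e, hac]
    · rw [← zpow_natCast, ← _root_.inv_inj, ← zpow_neg, ← e, hac, inv_one]
  have h1 : h.wtL i / h.wtL j = 1 :=
    IsMulTorsionFree.pow_left_injective (Int.natAbs_ne_zero.2 ha) (by simpa using hnat)
  rw [div_eq_one] at h1
  rw [← coe_wtL, ← coe_wtL, h1]

end RankOneBorelData

end Data

/-! ### `U_α` raises weights; the opposite root group -/

section Raise

namespace RankOneBorelData

open RankOneOrbitData (rho_mul_mulVec rho_mulVec_mem v_mem)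

variable {G T B : Subgroup (GL n k)} {α : ↥(characterLattice T)} {u : Multiplicative k →* ↥G}
  {m : GL n k} {N : ℕ} {ρ : ↥G →* GL (Fin N) k} {v : Fin N → k}
variable (h : RankOneBorelData G T B α u m ρ v)
include h

/-- The entries of `ρ(u(y))` are polynomials in `y` (`ρ` and `u` are algebraic). [folklore] -/
theorem exists_polynomial_rho_uval (i j : Fin N) :
    ∃ q : Polynomial k, ∀ y : k,
      q.eval y = ((ρ (u (Multiplicative.ofAdd y)) : GL (Fin N) k) : Matrix (Fin N) (Fin N) k) i j := by
  obtain ⟨Pu, hPu⟩ := h.rootHom.1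
  obtain ⟨Pρ, hPρ⟩ := h.algebraic
  refine ⟨MvPolynomial.aeval Pu (Pρ (Sum.inl (i, j))), fun y => ?_⟩
  rw [← glCoordFun_inl (g := ρ (u (Multiplicative.ofAdd y))) (i := i) (j := j), hPρ,
    ← Polynomial.coe_aeval_eq_eval, ← AlgHom.comp_apply, MvPolynomial.comp_aeval,
    MvPolynomial.aeval_eq_eval]
  refine congrArg (fun f => MvPolynomial.eval f (Pρ (Sum.inl (i, j)))) (funext fun c => ?_)
  rw [Polynomial.coe_aeval_eq_eval, hPu]

/-- **`T`-equivariance of `ρ(u(y))` in weight coordinates**: `ρ(u(α(t) y))ᵢⱼ = χᵢ(t) ρ(u(y))ᵢⱼ χⱼ(t)⁻¹`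
(from the root-homomorphism relation `t u(y) t⁻¹ = u(α(t) y)`, Springer 8.1.1 (i), and
`ρ(t) = diag(χᵢ(t))`). [folklore] -/
theorem rho_uval_conj (t : ↥T) (y : k) (i j : Fin N) :
    ((ρ (u (Multiplicative.ofAdd (((α : ↥T →* kˣ) t : k) * y))) : GL (Fin N) k) :
        Matrix (Fin N) (Fin N) k) i j =
      ((h.wt i t : kˣ) : k) * ((ρ (u (Multiplicative.ofAdd y)) : GL (Fin N) k) :
        Matrix (Fin N) (Fin N) k) i j * ((h.wt j t⁻¹ : kˣ) : k) := by
  have e := h.rootHom.2.2 t y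
  have e' : (Subgroup.inclusion h.maxTorus.1 t : ↥G) = ⟨(t : GL n k), h.maxTorus.1 t.2⟩ := rfl
  rw [← e, map_mul, map_mul, Units.val_mul, Units.val_mul, e']
  have e'' : (⟨(t : GL n k), h.maxTorus.1 t.2⟩ : ↥G)⁻¹ = ⟨((t⁻¹ : ↥T) : GL n k), h.maxTorus.1 (t⁻¹).2⟩ := rfl
  rw [e'', h.rho_torus_eq_diagonal t, h.rho_torus_eq_diagonal t⁻¹, Matrix.mul_diagonal,
    Matrix.diagonal_mul]
  rfl

/-- The twist identity for the entry polynomials along a cocharacter `γ` with `⟨α, γ⟩ = d`: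
`q_{ij}(c^d y) = c^{mᵢ - mⱼ} q_{ij}(y)`. [folklore] -/
theorem rho_uval_twist [IsAlgClosed k] [IsMulCommutative ↥T] (γ : ↥(cocharacterLattice T))
    (c : kˣ) (y : k) (i j : Fin N) :
    ((ρ (u (Multiplicative.ofAdd
        (((c ^ charPairingInt (α : ↥T →* kˣ) (γ : kˣ →* ↥T) : kˣ) : k) * y))) : GL (Fin N) k) :
        Matrix (Fin N) (Fin N) k) i j =
      ((c ^ (h.wtInt γ i - h.wtInt γ j) : kˣ) : k) *
        ((ρ (u (Multiplicative.ofAdd y)) : GL (Fin N) k) : Matrix (Fin N) (Fin N) k) i j := by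
  have hα := charPairingInt_spec_holds (T := T) α.2 γ.2 c
  have hi := charPairingInt_spec_holds (T := T) (h.isAlgebraicChar_wt i) γ.2 c
  have hj := charPairingInt_spec_holds (T := T) (h.isAlgebraicChar_wt j) γ.2 c
  rw [← hα, h.rho_uval_conj ((γ : kˣ →* ↥T) c) y i j, map_inv, hi, hj, zpow_sub, Units.val_mul]
  show _ = ((c ^ charPairingInt (h.wt i) (γ : kˣ →* ↥T) : kˣ) : k) *
    (((c ^ charPairingInt (h.wt j) (γ : kˣ →* ↥T))⁻¹ : kˣ) : k) * _
  ring

/-- **`U_α` raises `γ`-weights, I**: `ρ(u(y))ᵢⱼ = 0` if `mᵢ < mⱼ` (for `⟨α, γ⟩ > 0`; cf.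
`BigCellReduction.apply_eq_one_apply_of_diagonal_conj`). [folklore] -/
theorem rho_uval_apply_eq_zero [IsAlgClosed k] [IsMulCommutative ↥T] {γ : ↥(cocharacterLattice T)}
    (hd : 0 < charPairingInt (α : ↥T →* kˣ) (γ : kˣ →* ↥T)) {i j : Fin N}
    (hlt : h.wtInt γ i < h.wtInt γ j) (y : k) :
    ((ρ (u (Multiplicative.ofAdd y)) : GL (Fin N) k) : Matrix (Fin N) (Fin N) k) i j = 0 := by
  obtain ⟨q, hq⟩ := h.exists_polynomial_rho_uval i j
  have hq0 : q = 0 := by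
    ext e
    rw [Polynomial.coeff_zero]
    refine coeff_eq_zero_of_twist (d := charPairingInt (α : ↥T →* kˣ) (γ : kˣ →* ↥T))
      (Δ := h.wtInt γ i - h.wtInt γ j) (fun c y => ?_) ?_
    · rw [hq, hq, h.rho_uval_twist γ c y i j]
    · intro he
      have : (0 : ℤ) ≤ charPairingInt (α : ↥T →* kˣ) (γ : kˣ →* ↥T) * e := by positivity
      omega
  rw [← hq, hq0, Polynomial.eval_zero]

/-- **`U_α` raises `γ`-weights, II**: `ρ(u(y))ᵢⱼ = δᵢⱼ` if `mᵢ = mⱼ` (the entry polynomial is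
constant, and `u(0) = 1`). [folklore] -/
theorem rho_uval_apply_of_eq [IsAlgClosed k] [IsMulCommutative ↥T] {γ : ↥(cocharacterLattice T)}
    (hd : 0 < charPairingInt (α : ↥T →* kˣ) (γ : kˣ →* ↥T)) {i j : Fin N}
    (heq : h.wtInt γ i = h.wtInt γ j) (y : k) :
    ((ρ (u (Multiplicative.ofAdd y)) : GL (Fin N) k) : Matrix (Fin N) (Fin N) k) i j =
      if i = j then 1 else 0 := by
  obtain ⟨q, hq⟩ := h.exists_polynomial_rho_uval i j
  -- `q` is constant
  have hqc : ∀ e ≠ 0, q.coeff e = 0 := by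
    intro e he0
    refine coeff_eq_zero_of_twist (d := charPairingInt (α : ↥T →* kˣ) (γ : kˣ →* ↥T))
      (Δ := h.wtInt γ i - h.wtInt γ j) (fun c y => ?_) ?_
    · rw [hq, hq, h.rho_uval_twist γ c y i j]
    · rw [heq, sub_self]
      intro he
      rcases mul_eq_zero.1 he with h1 | h1
      · exact hd.ne' h1
      · exact he0 (by exact_mod_cast h1)
  have hconst : q = Polynomial.C (q.coeff 0) := by
    ext e
    rcases Nat.eq_zero_or_pos e with rfl | hpos
    · simp
    · rw [hqc e hpos.ne', Polynomial.coeff_C, if_neg hpos.ne']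
  have h0 := hq 0
  rw [ofAdd_zero, map_one, map_one, Units.val_one] at h0
  rw [← hq, hconst, Polynomial.eval_C, ← Polynomial.eval_C (a := q.coeff 0) (x := (0 : k)), ← hconst,
    h0, Matrix.one_apply]

/-- **`ρ(u(y))` on a vector of pure `γ`-weight `M`**: the coordinates of weight `M` are unchanged
and those of weight `< M` vanish. [folklore] -/
theorem rho_uval_mulVec_apply [IsAlgClosed k] [IsMulCommutative ↥T] {γ : ↥(cocharacterLattice T)}
    (hd : 0 < charPairingInt (α : ↥T →* kˣ) (γ : kˣ →* ↥T)) {z : Fin N → k} {M : ℤ}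
    (hz : ∀ j, z j ≠ 0 → h.wtInt γ j = M) (y : k) (i : Fin N) (hi : h.wtInt γ i ≤ M) :
    (((ρ (u (Multiplicative.ofAdd y)) : GL (Fin N) k) : Matrix (Fin N) (Fin N) k) *ᵥ z) i =
      if h.wtInt γ i = M then z i else 0 := by
  rw [Matrix.mulVec, dotProduct]
  split_ifs with hiM
  · rw [Finset.sum_eq_single i]
    · rw [h.rho_uval_apply_of_eq hd rfl, if_pos rfl, one_mul]
    · intro j _ hji
      by_cases hzj : z j = 0
      · rw [hzj, mul_zero]
      · rw [h.rho_uval_apply_of_eq hd (hiM.trans (hz j hzj).symm), if_neg (Ne.symm hji), zero_mul]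
    · intro hi'; exact absurd (Finset.mem_univ i) hi'
  · refine Finset.sum_eq_zero fun j _ => ?_
    by_cases hzj : z j = 0
    · rw [hzj, mul_zero]
    · rw [h.rho_uval_apply_eq_zero hd (lt_of_le_of_ne (hz j hzj ▸ hi) (hz j hzj ▸ hiM)), zero_mul]

/-! #### The opposite root group `m⁻¹ U m` -/

/-- `m` inverts `α`: `α(m t m⁻¹) = α(t)⁻¹` (`m ∈ N_G(T) ∖ Z_G(T)` acts on `α` by `-1`,
`charConj_eq_or_eq_inv_of_central`). [cite: SpringerLAG1998, 7.1.4] -/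
theorem charConj_eq_inv [IsAlgClosed k] : charConj h.memN α = α⁻¹ := by
  rcases charConj_eq_or_eq_inv_of_central h.alg h.torus h.ne_one h.central h.memG h.memN with e | e
  · exact absurd (mem_centralizer_of_charConj_eq_of_central h.alg h.torus h.ne_one h.central h.memG
      h.memN e) h.notMemZ
  · exact e

/-- The automorphism `t ↦ m t m⁻¹` of `T` as an equivalence. [folklore] -/
noncomputable def weylEquiv : ↥T ≃* ↥T :=
  { normConj h.memN with
    invFun := normConj (Subgroup.inv_mem _ h.memN)
    left_inv := fun t => Subtype.ext (by simp [mul_assoc])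
    right_inv := fun t => Subtype.ext (by simp [mul_assoc]) }

/-- `weylEquiv t = m t m⁻¹`. [folklore] -/
@[simp] theorem coe_weylEquiv (t : ↥T) : ((h.weylEquiv t : ↥T) : GL n k) = m * t * m⁻¹ := rfl

/-- **`x ↦ m⁻¹ u(x) m` is a root homomorphism for `-α`** (`n U_α n⁻¹ = U_{-α}`; an instance of the
tree's `IsRootHom.conj`, Springer 8.1.1 (i) with 7.1.4). The equivalence `weylEquiv` only uses
`m ∈ N_G(T)` and could live next to `normConj` (`RootSubgroupStructure.lean`).
[cite: SpringerLAG1998, 8.1.1 (i) with 7.1.4] -/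
theorem isRootHom_weyl [IsAlgClosed k] :
    IsRootHom G T h.maxTorus.1 (α : ↥T →* kˣ)⁻¹
      ((MulAut.conj (⟨m, h.memG⟩⁻¹ : ↥G)).toMonoidHom.comp u) := by
  have h1 := h.rootHom.conj (m := (⟨m, h.memG⟩⁻¹ : ↥G)) (σ := h.weylEquiv) fun t =>
    Subtype.ext (by simp [mul_assoc])
  have e : (α : ↥T →* kˣ).comp h.weylEquiv.toMonoidHom = (α : ↥T →* kˣ)⁻¹ := by
    have h2 := congrArg (fun χ : ↥(characterLattice T) => (χ : ↥T →* kˣ)) h.charConj_eq_inv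
    rw [Subgroup.coe_inv] at h2
    rw [← h2]
    rfl
  rwa [e] at h1

/-- `uval` of the opposite root homomorphism. [folklore] -/
theorem uval_weyl (y : k) :
    uval ((MulAut.conj (⟨m, h.memG⟩⁻¹ : ↥G)).toMonoidHom.comp u) y = m⁻¹ * uval u y * m := by
  simp [uval]

/-- **`U_α ∩ m B m⁻¹ = {e}` on the level of the orbit**: if `ρ(u(y))` fixes `z₀ = ρ(m) v` then
`y = 0` (`m⁻¹ u(y) m` stabilises `[v]`, so lies in `B`; then `inter`). [cite: SpringerLAG1998, 7.2.3 (i)] -/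
theorem eq_zero_of_rho_uval_fix [IsAlgClosed k] {y : k}
    (hfix : ((ρ (u (Multiplicative.ofAdd y)) : GL (Fin N) k) : Matrix (Fin N) (Fin N) k) *ᵥ
      (((ρ ⟨m, h.memG⟩ : GL (Fin N) k) : Matrix (Fin N) (Fin N) k) *ᵥ v) =
      ((ρ ⟨m, h.memG⟩ : GL (Fin N) k) : Matrix (Fin N) (Fin N) k) *ᵥ v) : y = 0 := by
  refine h.inter y ?_
  have := h.conj_mem_borel_of_fixed (g := ⟨m, h.memG⟩) (t := uval u y) (uval_mem u y)
    ⟨1, by rw [one_smul]; exact hfix⟩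
  simpa [uval] using this

end RankOneBorelData

end Raise

/-! ### The orbit cone: eigenlines, limits, extremal weights, charts -/

section Cone

namespace RankOneBorelData

open RankOneOrbitData (rho_mul_mulVec rho_mulVec_mem v_mem)

variable {G T B : Subgroup (GL n k)} {α : ↥(characterLattice T)} {u : Multiplicative k →* ↥G}
  {m : GL n k} {N : ℕ} {ρ : ↥G →* GL (Fin N) k} {v : Fin N → k}
variable (h : RankOneBorelData G T B α u m ρ v)
include h

/-- The lowest weight vector `z₀ = ρ(m) v` (Springer's `y_∞`). [cite: SpringerLAG1998, 7.1.5 (proof)] -/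
noncomputable def z0 : Fin N → k :=
  ((ρ ⟨m, h.memG⟩ : GL (Fin N) k) : Matrix (Fin N) (Fin N) k) *ᵥ v

/-- `z₀ = ρ(m) v`. [folklore] -/
theorem z0_def : h.z0 = ((ρ ⟨m, h.memG⟩ : GL (Fin N) k) : Matrix (Fin N) (Fin N) k) *ᵥ v := rfl

/-- `z₀` lies in the orbit cone. [folklore] -/
theorem z0_mem : h.z0 ∈ orbitCone ρ.range v := rho_mulVec_mem _ v_mem

/-- `z₀ ≠ 0`. [folklore] -/
theorem z0_ne_zero : h.z0 ≠ 0 := by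
  intro h0
  apply h.ne_zero
  have := congrArg (fun w => (((ρ ⟨m, h.memG⟩ : GL (Fin N) k)⁻¹ : GL (Fin N) k) :
    Matrix (Fin N) (Fin N) k) *ᵥ w) h0
  simpa [z0, Matrix.mulVec_mulVec, ← Units.val_mul] using this

/-- `v` is a `T`-eigenvector. [folklore] -/
theorem exists_rho_torus_v (t : ↥T) :
    ∃ c : k, ((ρ ⟨t, h.maxTorus.1 t.2⟩ : GL (Fin N) k) : Matrix (Fin N) (Fin N) k) *ᵥ v = c • v :=
  h.exists_smul_of_mem_borel (h.maxTorus.1 t.2) (h.torus_le t.2)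

/-- `z₀` is a `T`-eigenvector (`ρ(t) ρ(m) v = ρ(m) ρ(m⁻¹ t m) v`). [folklore] -/
theorem exists_rho_torus_z0 (t : ↥T) :
    ∃ c : k, ((ρ ⟨t, h.maxTorus.1 t.2⟩ : GL (Fin N) k) : Matrix (Fin N) (Fin N) k) *ᵥ h.z0 =
      c • h.z0 := by
  have ht' : m⁻¹ * t * m ∈ T := (Subgroup.mem_normalizer_iff''.1 h.memN _).1 t.2
  obtain ⟨c, hc⟩ := h.exists_rho_torus_v ⟨_, ht'⟩
  refine ⟨c, ?_⟩
  rw [z0, ← rho_mul_mulVec, show (⟨(t : GL n k), h.maxTorus.1 t.2⟩ : ↥G) * ⟨m, h.memG⟩ =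
    ⟨m, h.memG⟩ * ⟨m⁻¹ * t * m, h.maxTorus.1 ht'⟩ from Subtype.ext (by simp [mul_assoc]),
    rho_mul_mulVec, hc, Matrix.mulVec_smul]

/-- The characters on the support of a `T`-eigenvector agree. [folklore] -/
theorem wt_eq_of_eigen {w : Fin N → k}
    (hfix : ∀ t : ↥T, ∃ c : k, ((ρ ⟨t, h.maxTorus.1 t.2⟩ : GL (Fin N) k) :
      Matrix (Fin N) (Fin N) k) *ᵥ w = c • w) {i j : Fin N} (hi : w i ≠ 0) (hj : w j ≠ 0) :
    h.wt i = h.wt j := by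
  ext t : 2
  have h1 := hfix t
  rw [h.rho_torus_mulVec, exists_smul_iff_forall_eq] at h1
  exact h1 i j hi hj

/-- A point of the orbit cone whose line is `T`-fixed is a multiple of `v` or of `z₀`. [cite: SpringerLAG1998, 7.1.5 (proof)] -/
theorem smul_or_smul_of_fixed_mem [IsAlgClosed k] {w : Fin N → k} (hw : w ∈ orbitCone ρ.range v)
    (hfix : ∀ t : ↥T, ∃ c : k, ((ρ ⟨t, h.maxTorus.1 t.2⟩ : GL (Fin N) k) :
      Matrix (Fin N) (Fin N) k) *ᵥ w = c • w) :
    (∃ c : k, w = c • v) ∨ ∃ c : k, w = c • h.z0 := by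
  obtain ⟨a, _, ⟨g, rfl⟩, rfl⟩ := hw
  by_cases ha : a = 0
  · exact Or.inl ⟨0, by rw [ha, zero_smul, zero_smul]⟩
  have hfix' : ∀ t : ↥T, ∃ c : k, ((ρ ⟨t, h.maxTorus.1 t.2⟩ : GL (Fin N) k) :
      Matrix (Fin N) (Fin N) k) *ᵥ (((ρ g : GL (Fin N) k) : Matrix (Fin N) (Fin N) k) *ᵥ v) =
      c • (((ρ g : GL (Fin N) k) : Matrix (Fin N) (Fin N) k) *ᵥ v) := by
    intro t
    obtain ⟨c, hc⟩ := hfix t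
    refine ⟨c, ?_⟩
    rw [Matrix.mulVec_smul, smul_comm] at hc
    exact smul_right_injective _ ha hc
  rcases h.smul_or_smul_of_fixed hfix' with ⟨c, hc⟩ | ⟨c, hc⟩
  · exact Or.inl ⟨a * c, by rw [hc, smul_smul]⟩
  · exact Or.inr ⟨a * c, by rw [hc, smul_smul]; rfl⟩

variable [IsAlgClosed k] [IsMulCommutative ↥T]

/-- **The lowest-weight part of a point of the (closed) orbit cone lies in the orbit cone**
(`ConeWeights.botPart_mem_of_isClosed` with `ρ(γ(c)) = diag(c^{mᵢ})`). [cite: SpringerLAG1998, 7.1.5 (proof)] -/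
theorem botPart_mem (γ : ↥(cocharacterLattice T)) {w : Fin N → k} (hw : w ∈ orbitCone ρ.range v) :
    botPart (h.wtInt γ) w ∈ orbitCone ρ.range v :=
  botPart_mem_of_isClosed _ _ isConeSet_orbitCone h.closed fun c => by
    rw [← h.rho_cochar γ c]; exact rho_mulVec_mem _ hw

/-- The highest-weight part likewise. [cite: SpringerLAG1998, 7.1.5 (proof)] -/
theorem topPart_mem (γ : ↥(cocharacterLattice T)) {w : Fin N → k} (hw : w ∈ orbitCone ρ.range v) :
    botPart (fun i => -h.wtInt γ i) w ∈ orbitCone ρ.range v :=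
  topPart_mem_of_isClosed _ _ isConeSet_orbitCone h.closed fun c => by
    rw [← h.rho_cochar γ c]; exact rho_mulVec_mem _ hw

/-- **The limit points are `T`-fixed**: the line of the lowest-weight part of a point of the
orbit cone is fixed by `ρ(T)` (separation of weights). [cite: SpringerLAG1998, 7.1.5 (proof)] -/
theorem botPart_fixed_torus {γ : ↥(cocharacterLattice T)}
    (hγ : charPairingInt (α : ↥T →* kˣ) (γ : kˣ →* ↥T) ≠ 0) {w : Fin N → k}
    (hw : w ∈ orbitCone ρ.range v) (t : ↥T) :
    ∃ c : k, ((ρ ⟨t, h.maxTorus.1 t.2⟩ : GL (Fin N) k) : Matrix (Fin N) (Fin N) k) *ᵥ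
      botPart (h.wtInt γ) w = c • botPart (h.wtInt γ) w := by
  rw [h.rho_torus_mulVec, exists_smul_iff_forall_eq]
  intro i j hi hj
  have e := h.wt_eq_of_wtInt_eq hγ (h.botPart_mem γ hw) hi hj
    ((botPart_apply_ne_zero _ _ hi).2.trans (botPart_apply_ne_zero _ _ hj).2.symm)
  rw [e]

/-- The same for the highest-weight part. [cite: SpringerLAG1998, 7.1.5 (proof)] -/
theorem topPart_fixed_torus {γ : ↥(cocharacterLattice T)}
    (hγ : charPairingInt (α : ↥T →* kˣ) (γ : kˣ →* ↥T) ≠ 0) {w : Fin N → k}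
    (hw : w ∈ orbitCone ρ.range v) (t : ↥T) :
    ∃ c : k, ((ρ ⟨t, h.maxTorus.1 t.2⟩ : GL (Fin N) k) : Matrix (Fin N) (Fin N) k) *ᵥ
      botPart (fun i => -h.wtInt γ i) w = c • botPart (fun i => -h.wtInt γ i) w := by
  rw [h.rho_torus_mulVec, exists_smul_iff_forall_eq]
  intro i j hi hj
  have e1 := (botPart_apply_ne_zero _ _ hi).2
  have e2 := (botPart_apply_ne_zero _ _ hj).2
  have e := h.wt_eq_of_wtInt_eq hγ (h.topPart_mem γ hw) hi hj (by
    have := e1.trans e2.symm; simpa using this)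
  rw [e]

/-- **`lim_{c → 0}` of a point of `G · [v]` is `[v]` or `[z₀]`.** [cite: SpringerLAG1998, 7.1.5 (proof)] -/
theorem botPart_smul_or_smul {γ : ↥(cocharacterLattice T)}
    (hγ : charPairingInt (α : ↥T →* kˣ) (γ : kˣ →* ↥T) ≠ 0) {w : Fin N → k}
    (hw : w ∈ orbitCone ρ.range v) :
    (∃ c : k, botPart (h.wtInt γ) w = c • v) ∨ ∃ c : k, botPart (h.wtInt γ) w = c • h.z0 :=
  h.smul_or_smul_of_fixed_mem (h.botPart_mem γ hw) (h.botPart_fixed_torus hγ hw)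

/-- **`lim_{c → ∞}` of a point of `G · [v]` is `[v]` or `[z₀]`.** [cite: SpringerLAG1998, 7.1.5 (proof)] -/
theorem topPart_smul_or_smul {γ : ↥(cocharacterLattice T)}
    (hγ : charPairingInt (α : ↥T →* kˣ) (γ : kˣ →* ↥T) ≠ 0) {w : Fin N → k}
    (hw : w ∈ orbitCone ρ.range v) :
    (∃ c : k, botPart (fun i => -h.wtInt γ i) w = c • v) ∨
      ∃ c : k, botPart (fun i => -h.wtInt γ i) w = c • h.z0 :=
  h.smul_or_smul_of_fixed_mem (h.topPart_mem γ hw) (h.topPart_fixed_torus hγ hw)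

/-! #### The extremal weights `M₀` (of `v`) and `M_∞` (of `z₀`) -/

variable (γ : ↥(cocharacterLattice T))

/-- The `γ`-weight `M₀` of `v`. [cite: SpringerLAG1998, 7.1.5 (proof)] -/
noncomputable def Mv : ℤ := minWeight (h.wtInt γ) v

/-- The `γ`-weight `M_∞` of `z₀`. [cite: SpringerLAG1998, 7.1.5 (proof)] -/
noncomputable def Mz : ℤ := minWeight (h.wtInt γ) h.z0

variable {γ}

omit [IsAlgClosed k] in
/-- A `T`-eigenvector has a single `γ`-weight, its `minWeight`. [folklore] -/
theorem wtInt_eq_minWeight_of_eigen {w : Fin N → k} (hw0 : w ≠ 0)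
    (hfix : ∀ t : ↥T, ∃ c : k, ((ρ ⟨t, h.maxTorus.1 t.2⟩ : GL (Fin N) k) :
      Matrix (Fin N) (Fin N) k) *ᵥ w = c • w) {j : Fin N} (hj : w j ≠ 0) :
    h.wtInt γ j = minWeight (h.wtInt γ) w := by
  obtain ⟨i, hi⟩ := Function.ne_iff.1 (botPart_ne_zero (h.wtInt γ) w hw0)
  replace hi : botPart (h.wtInt γ) w i ≠ 0 := by simpa using hi
  obtain ⟨hwi, hmi⟩ := botPart_apply_ne_zero _ _ hi
  rw [← hmi]
  simp only [wtInt]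
  rw [h.wt_eq_of_eigen hfix hj hwi]

omit [IsAlgClosed k] in
/-- `v` has pure weight `M₀`. [folklore] -/
theorem wtInt_eq_Mv {j : Fin N} (hj : v j ≠ 0) : h.wtInt γ j = h.Mv γ :=
  h.wtInt_eq_minWeight_of_eigen h.ne_zero h.exists_rho_torus_v hj

omit [IsAlgClosed k] in
/-- `z₀` has pure weight `M_∞`. [folklore] -/
theorem wtInt_eq_Mz {j : Fin N} (hj : h.z0 j ≠ 0) : h.wtInt γ j = h.Mz γ :=
  h.wtInt_eq_minWeight_of_eigen h.z0_ne_zero h.exists_rho_torus_z0 hj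

/-- The top weight of a non-zero point of the orbit cone is `M₀` or `M_∞`. [cite: SpringerLAG1998, 7.1.5 (proof)] -/
theorem maxWeight_eq_or (hγ : charPairingInt (α : ↥T →* kˣ) (γ : kˣ →* ↥T) ≠ 0) {w : Fin N → k}
    (hw : w ∈ orbitCone ρ.range v) (hw0 : w ≠ 0) :
    -minWeight (fun i => -h.wtInt γ i) w = h.Mv γ ∨ -minWeight (fun i => -h.wtInt γ i) w = h.Mz γ := by
  obtain ⟨i, hi⟩ := Function.ne_iff.1 (botPart_ne_zero (fun i => -h.wtInt γ i) w hw0)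
  replace hi : botPart (fun i => -h.wtInt γ i) w i ≠ 0 := by simpa using hi
  obtain ⟨hwi, hmi⟩ := botPart_apply_ne_zero _ _ hi
  rcases h.topPart_smul_or_smul hγ hw with ⟨c, hc⟩ | ⟨c, hc⟩
  · left
    have hvi : v i ≠ 0 := by
      intro h0; apply hi; rw [hc, Pi.smul_apply, h0, smul_zero]
    rw [← h.wtInt_eq_Mv hvi, ← hmi, neg_neg]
  · right
    have hzi : h.z0 i ≠ 0 := by
      intro h0; apply hi; rw [hc, Pi.smul_apply, h0, smul_zero]
    rw [← h.wtInt_eq_Mz hzi, ← hmi, neg_neg]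

/-- The bottom weight of a non-zero point of the orbit cone is `M₀` or `M_∞`. [cite: SpringerLAG1998, 7.1.5 (proof)] -/
theorem minWeight_eq_or (hγ : charPairingInt (α : ↥T →* kˣ) (γ : kˣ →* ↥T) ≠ 0) {w : Fin N → k}
    (hw : w ∈ orbitCone ρ.range v) (hw0 : w ≠ 0) :
    minWeight (h.wtInt γ) w = h.Mv γ ∨ minWeight (h.wtInt γ) w = h.Mz γ := by
  obtain ⟨i, hi⟩ := Function.ne_iff.1 (botPart_ne_zero (h.wtInt γ) w hw0)
  replace hi : botPart (h.wtInt γ) w i ≠ 0 := by simpa using hi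
  obtain ⟨hwi, hmi⟩ := botPart_apply_ne_zero _ _ hi
  rcases h.botPart_smul_or_smul hγ hw with ⟨c, hc⟩ | ⟨c, hc⟩
  · left
    have hvi : v i ≠ 0 := by
      intro h0; apply hi; rw [hc, Pi.smul_apply, h0, smul_zero]
    rw [← h.wtInt_eq_Mv hvi, ← hmi]
  · right
    have hzi : h.z0 i ≠ 0 := by
      intro h0; apply hi; rw [hc, Pi.smul_apply, h0, smul_zero]
    rw [← h.wtInt_eq_Mz hzi, ← hmi]

/-- **Orientation: `M_∞ < M₀`** (Springer 7.1.5: the weights are ordered so that `e₀` has the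
highest weight; here: `ρ(u(1)) z₀ ≠ z₀` by `eq_zero_of_rho_uval_fix`, so `ρ(u(1)) z₀` has a
coordinate of weight `> M_∞` since `U_α` raises weights, and its top weight is `M₀` or `M_∞`).
[cite: SpringerLAG1998, 7.1.5 (proof)] -/
theorem Mz_lt_Mv (hd : 0 < charPairingInt (α : ↥T →* kˣ) (γ : kˣ →* ↥T)) : h.Mz γ < h.Mv γ := by
  set w := ((ρ (u (Multiplicative.ofAdd (1 : k))) : GL (Fin N) k) : Matrix (Fin N) (Fin N) k) *ᵥ h.z0
    with hw
  have hwC : w ∈ orbitCone ρ.range v := rho_mulVec_mem _ h.z0_mem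
  have hz : ∀ j, h.z0 j ≠ 0 → h.wtInt γ j = h.Mz γ := fun j hj => h.wtInt_eq_Mz hj
  -- a coordinate of `w` of weight `> M_∞`
  obtain ⟨i, hwi, hgt⟩ : ∃ i, w i ≠ 0 ∧ h.Mz γ < h.wtInt γ i := by
    by_contra hcon
    push Not at hcon
    have hwz : w = h.z0 := by
      funext i
      by_cases hle : h.wtInt γ i ≤ h.Mz γ
      · rw [hw, h.rho_uval_mulVec_apply hd hz 1 i hle]
        split_ifs with heq
        · rfl
        · by_contra hzi
          exact heq (hz i (Ne.symm hzi))
      · push Not at hle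
        have h1 : w i = 0 := by
          by_contra hwi; exact absurd (hcon i hwi) (not_le.2 hle)
        rw [h1]
        by_contra hzi
        exact absurd (hz i (Ne.symm hzi)) (ne_of_gt hle)
    have hwz' : ((ρ (u (Multiplicative.ofAdd (1 : k))) : GL (Fin N) k) : Matrix (Fin N) (Fin N) k) *ᵥ
        (((ρ ⟨m, h.memG⟩ : GL (Fin N) k) : Matrix (Fin N) (Fin N) k) *ᵥ v) =
        ((ρ ⟨m, h.memG⟩ : GL (Fin N) k) : Matrix (Fin N) (Fin N) k) *ᵥ v := hwz
    exact one_ne_zero (h.eq_zero_of_rho_uval_fix hwz')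
  have hw0 : w ≠ 0 := fun h0 => hwi (by rw [h0]; rfl)
  have htop : h.wtInt γ i ≤ -minWeight (fun i => -h.wtInt γ i) w := by
    have := minWeight_le (fun i => -h.wtInt γ i) w hwi
    linarith
  rcases h.maxWeight_eq_or hd.ne' hwC hw0 with e | e
  · rw [e] at htop; exact lt_of_lt_of_le hgt htop
  · rw [e] at htop; exact absurd htop (not_le.2 hgt)

/-- Weights of the non-zero coordinates of a point of the orbit cone lie in `[M_∞, M₀]`. [folklore] -/
theorem wtInt_mem_Icc (hd : 0 < charPairingInt (α : ↥T →* kˣ) (γ : kˣ →* ↥T)) {w : Fin N → k}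
    (hw : w ∈ orbitCone ρ.range v) {i : Fin N} (hi : w i ≠ 0) :
    h.Mz γ ≤ h.wtInt γ i ∧ h.wtInt γ i ≤ h.Mv γ := by
  have hw0 : w ≠ 0 := fun h0 => hi (by rw [h0]; rfl)
  have hlt := h.Mz_lt_Mv hd
  have h1 := minWeight_le (h.wtInt γ) w hi
  have h2 := minWeight_le (fun i => -h.wtInt γ i) w hi
  constructor
  · rcases h.minWeight_eq_or hd.ne' hw hw0 with e | e <;> rw [e] at h1 <;> linarith
  · rcases h.maxWeight_eq_or hd.ne' hw hw0 with e | e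
    · have : h.wtInt γ i ≤ -minWeight (fun i => -h.wtInt γ i) w := by linarith
      rw [e] at this; exact this
    · have : h.wtInt γ i ≤ -minWeight (fun i => -h.wtInt γ i) w := by linarith
      rw [e] at this; linarith

/-- **The chart at `x_∞`: `X ∖ {x₀} ⊆ Ω_∞`.** A non-zero point of the orbit cone which is not a
multiple of `v` has lowest weight `M_∞`, and its weight-`M_∞` part is a non-zero multiple of `z₀`
(Springer 7.1.5: "*if the last coordinate of `x` is non-zero, then `x₀* = lim ρ(a) x*` exists*",
read backwards). [cite: SpringerLAG1998, 7.1.5 (proof)] -/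
theorem exists_low_coords (hd : 0 < charPairingInt (α : ↥T →* kˣ) (γ : kˣ →* ↥T)) {w : Fin N → k}
    (hw : w ∈ orbitCone ρ.range v) (hw0 : w ≠ 0) (hnv : ¬ ∃ c : k, w = c • v) :
    ∃ c : k, c ≠ 0 ∧ ∀ i, h.wtInt γ i = h.Mz γ → w i = c * h.z0 i := by
  have hlt := h.Mz_lt_Mv hd
  -- the lowest weight of `w` is `M_∞`
  have hmin : minWeight (h.wtInt γ) w = h.Mz γ := by
    rcases h.minWeight_eq_or hd.ne' hw hw0 with e | e
    · exfalso
      -- then `w` is pure of weight `M₀`, hence equal to its bottom part, a multiple of `v`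
      have hpure : ∀ i, w i ≠ 0 → h.wtInt γ i = h.Mv γ := fun i hi =>
        le_antisymm (h.wtInt_mem_Icc hd hw hi).2 (e ▸ minWeight_le (h.wtInt γ) w hi)
      have hwb : w = botPart (h.wtInt γ) w := by
        funext i
        by_cases hi : w i = 0
        · unfold botPart; split_ifs <;> simp [hi]
        · unfold botPart; rw [if_pos ((hpure i hi).trans e.symm)]
      rcases h.botPart_smul_or_smul hd.ne' hw with ⟨c, hc⟩ | ⟨c, hc⟩
      · exact hnv ⟨c, hwb.trans hc⟩
      · obtain ⟨i, hi⟩ := Function.ne_iff.1 hw0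
        replace hi : w i ≠ 0 := by simpa using hi
        have hzi : h.z0 i ≠ 0 := by
          intro h0
          apply hi
          rw [hwb, hc, Pi.smul_apply, h0, smul_zero]
        have := (hpure i hi).symm.trans (h.wtInt_eq_Mz hzi)
        exact absurd this (ne_of_gt hlt)
    · exact e
  rcases h.botPart_smul_or_smul hd.ne' hw with ⟨c, hc⟩ | ⟨c, hc⟩
  · exfalso
    obtain ⟨i, hi⟩ := Function.ne_iff.1 (botPart_ne_zero (h.wtInt γ) w hw0)
    replace hi : botPart (h.wtInt γ) w i ≠ 0 := by simpa using hi
    have hvi : v i ≠ 0 := by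
      intro h0; apply hi; rw [hc, Pi.smul_apply, h0, smul_zero]
    have e1 := (botPart_apply_ne_zero _ _ hi).2
    rw [hmin, h.wtInt_eq_Mv hvi] at e1
    exact absurd e1 (ne_of_gt hlt)
  · refine ⟨c, ?_, fun i hi => ?_⟩
    · rintro rfl
      rw [zero_smul] at hc
      exact botPart_ne_zero _ _ hw0 hc
    · have := congrFun hc i
      rw [Pi.smul_apply, smul_eq_mul] at this
      rw [← this]
      unfold botPart
      rw [if_pos (hi.trans hmin.symm)]

/-- **The chart at `x₀`: `X ∖ {x_∞} ⊆ Ω₀`.** A non-zero point of the orbit cone which is not a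
multiple of `z₀` has top weight `M₀` and weight-`M₀` part a non-zero multiple of `v`. [cite: SpringerLAG1998, 7.1.5 (proof)] -/
theorem exists_high_coords (hd : 0 < charPairingInt (α : ↥T →* kˣ) (γ : kˣ →* ↥T)) {w : Fin N → k}
    (hw : w ∈ orbitCone ρ.range v) (hw0 : w ≠ 0) (hnz : ¬ ∃ c : k, w = c • h.z0) :
    ∃ c : k, c ≠ 0 ∧ ∀ i, h.wtInt γ i = h.Mv γ → w i = c * v i := by
  have hlt := h.Mz_lt_Mv hd
  have hmax : -minWeight (fun i => -h.wtInt γ i) w = h.Mv γ := by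
    rcases h.maxWeight_eq_or hd.ne' hw hw0 with e | e
    · exact e
    · exfalso
      have hpure : ∀ i, w i ≠ 0 → h.wtInt γ i = h.Mz γ := fun i hi => by
        refine le_antisymm ?_ (h.wtInt_mem_Icc hd hw hi).1
        have := minWeight_le (fun i => -h.wtInt γ i) w hi
        linarith
      have hwb : w = botPart (fun i => -h.wtInt γ i) w := by
        funext i
        by_cases hi : w i = 0
        · unfold botPart; split_ifs <;> simp [hi]
        · unfold botPart
          rw [if_pos]
          have := hpure i hi
          linarith
      rcases h.topPart_smul_or_smul hd.ne' hw with ⟨c, hc⟩ | ⟨c, hc⟩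
      · obtain ⟨i, hi⟩ := Function.ne_iff.1 hw0
        replace hi : w i ≠ 0 := by simpa using hi
        have hvi : v i ≠ 0 := by
          intro h0
          apply hi
          rw [hwb, hc, Pi.smul_apply, h0, smul_zero]
        have := (hpure i hi).symm.trans (h.wtInt_eq_Mv hvi)
        exact absurd this (ne_of_lt hlt)
      · exact hnz ⟨c, hwb.trans hc⟩
  rcases h.topPart_smul_or_smul hd.ne' hw with ⟨c, hc⟩ | ⟨c, hc⟩
  · refine ⟨c, ?_, fun i hi => ?_⟩
    · rintro rfl
      rw [zero_smul] at hc
      exact botPart_ne_zero _ _ hw0 hc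
    · have := congrFun hc i
      rw [Pi.smul_apply, smul_eq_mul] at this
      rw [← this]
      unfold botPart
      rw [if_pos]
      linarith
  · exfalso
    obtain ⟨i, hi⟩ := Function.ne_iff.1 (botPart_ne_zero (fun i => -h.wtInt γ i) w hw0)
    replace hi : botPart (fun i => -h.wtInt γ i) w i ≠ 0 := by simpa using hi
    have hzi : h.z0 i ≠ 0 := by
      intro h0; apply hi; rw [hc, Pi.smul_apply, h0, smul_zero]
    have e1 := (botPart_apply_ne_zero _ _ hi).2
    have e2 := h.wtInt_eq_Mz (γ := γ) hzi
    have : h.wtInt γ i = h.Mv γ := by linarith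
    exact absurd (e2.symm.trans this) (ne_of_lt hlt)

end RankOneBorelData

end Cone


/-! ### The old data as a special case -/

section SpecialCase

/-- **`RankOneOrbitData` is the special case `B = T · U_α`, `Z_G(T) = T` of `RankOneBorelData`**
(`inter` being `RankOneOrbitData.eq_zero_of_rho_uval_fix`'s group-theoretic core: an element
`t u(x)` of `T · U_α` of the form `m⁻¹ u(y) m` has `y = 0`, by the opposite-weights lemma
`IsRootHom.eq_zero_of_uval_eq_torus_mul_uval`). [folklore] -/
theorem _root_.Literature.NumberTheory.Automorphic.RankOneOrbitData.toBorelData [IsAlgClosed k]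
    {G T : Subgroup (GL n k)} {α : ↥(characterLattice T)} {u : Multiplicative k →* ↥G}
    {m : GL n k} {N : ℕ} {ρ : ↥G →* GL (Fin N) k} {v : Fin N → k}
    (h : RankOneOrbitData G T α u m ρ v) :
    RankOneBorelData G T (T ⊔ u.range.map G.subtype) α u m ρ v where
  conn := h.conn
  maxTorus := h.maxTorus
  mem_roots := h.mem_roots
  central := h.central
  rootHom := h.rootHom
  borel := h.borel
  torus_le := le_sup_left
  range_le := le_sup_right
  centralizer_le := by rw [h.centralizer_eq]; exact le_sup_left
  memG := h.memG
  memN := h.memN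
  notMemB := h.not_mem_borel
  inter y hy := by
    haveI : IsMulCommutative ↥T := h.torus.2.1
    obtain ⟨t, ht, x, e⟩ := h.rootHom.mem_sup_iff.1 hy
    rw [← h.uval_weyl] at e
    exact (h.rootHom.eq_zero_of_uval_eq_torus_mul_uval h.isRootHom_weyl
      (surjective_of_mem_roots h.torus h.mem_roots) ht e).1
  algebraic := h.algebraic
  ne_zero := h.ne_zero
  stab_iff := h.stab_iff
  diag := h.diag
  closed := h.closed

end SpecialCase

end Literature.NumberTheory.Automorphic
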